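import Summits.HodgeConjecture.HodgeConjecture.Theorems.CyclicUnitaryPowersCyclicCoverIrreducible
import Literature.AlgebraicGeometry.HodgeTheory.CompleteIntersectionHilbertFunction

/-!
# Route `CyclicUnitaryPowers`, crux K1-A (stmt-HodgeConjecture-19544): two identities of the Hilbert function
# of the Jacobian ring of a smooth ternary form (complete intersection of type `(p−1, p−1, p−1)`)

For a ternary form `f` of degree `p` whose Jacobian ring `R_f = ℂ[x₀,x₁,x₂]/(∂₀f, ∂₁f, ∂₂f)` is Artinian
(`V(f)` smooth), Macaulay's theorem (tree: `hilbert_jacobianIdeal_eq_card`) gives `dim R_f^a = #{β ∈ ℕ³ :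
|β| = a, βᵢ ≤ p − 2}`. The eigen-Hodge numbers of the `p`-cyclic covers `x₃^p = f` come out of Griffiths' residues
at pole order ONE and Hodge symmetry in the "residue form" `dim R_f^{p−3−i}`, `dim R_f^{i−3}`,
`(p² − 3p + 3) − dim R_f^{p−3−i} − dim R_f^{i−3}` (`CyclicUnitaryPowersEigenHodgeOfGeometricGenus`), while the
binder `carlsonToledo1999_finrank_eigenspace_inf_hodgePiece` spells them (pole orders `2`, `3`) as
`dim R_f^{2p−3−i}`, `dim R_f^{3p−3−i}`. This file PROVES the two purely combinatorial identities reconciling the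
spellings (`1 ≤ i ≤ p − 1`):

* `hilbert_jacobianIdeal_symm` — **Gorenstein symmetry** `dim R_f^{3p−3−i} = dim R_f^{i−3}` (`0` for `i < 3`):
  the box involution `β ↦ (p−2, p−2, p−2) − β`;
* `hilbert_jacobianIdeal_three_term` — **`dim R_f^{p−3−i} + dim R_f^{2p−3−i} + dim R_f^{3p−3−i} = p² − 3p + 3`**
  (first term `0` for `p < 3 + i`): the three degrees are the members `≡ −3 − i (mod p)` of `[0, 3p − 6]`, and
  the number of `β ∈ [0, p−2]³` with `p ∣ |β| + i + 3` is `(p−1)(p−2) + 1`, by peeling off one coordinate at a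
  time (each residue class mod `p` meets `[0, p−2]` exactly once, except the class of `p − 1`).

References: F. S. Macaulay (1927) / A. Iarrobino–V. Kanev (1999) (Hilbert function of a complete intersection);
J. Carlson, D. Toledo, Duke Math. J. 97 (1999) §5; R. Kloosterman (2023) §2 eq. (1).
-/

noncomputable section

open MvPolynomial Finset

-- mandated namespace `Summit.HodgeConjecture.HodgeConjecture.Theorems` trips `linter.dupNamespace` (off tree-wide)
set_option linter.dupNamespace false

namespace Summit.HodgeConjecture.HodgeConjecture.Theorems.CyclicUnitaryPowersJacobianHilbertIdentities

open Literature.AlgebraicGeometry.Motives Literature.AlgebraicGeometry.HodgeTheory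
open Literature.RingTheory.MvPolynomial (idealDegree)

/-! ### §1 Counting one coordinate at a time -/

section Counting

variable {p : ℕ}

/-- **Each residue class mod `p` meets `[0, p)` exactly once**: `#{z < p : p ∣ z + c} = 1`. [folklore] -/
theorem card_filter_range_dvd_add (hp : 0 < p) (c : ℕ) :
    ((Finset.range p).filter fun z => p ∣ z + c).card = 1 := by
  set r := c % p with hr
  have hrp : r < p := Nat.mod_lt c hp
  have hc : c = p * (c / p) + r := (Nat.div_add_mod c p).symm
  -- `p ∣ z + c ↔ p ∣ z + r`
  have hiff : ∀ z, p ∣ z + c ↔ p ∣ z + r := fun z ↦ by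
    rw [hc, ← add_assoc, add_comm z, add_assoc]
    exact (Nat.dvd_add_right (dvd_mul_right p (c / p)))
  rw [Finset.card_eq_one]
  refine ⟨(p - r) % p, ?_⟩
  ext z
  simp only [Finset.mem_filter, Finset.mem_range, Finset.mem_singleton, hiff]
  constructor
  · rintro ⟨hz, k, hk⟩
    have hk2 : k < 2 := Nat.lt_of_mul_lt_mul_left (a := p) (by omega)
    interval_cases k
    · have hz0 : z = 0 := by omega
      have hr0 : r = 0 := by omega
      rw [hz0, hr0, Nat.sub_zero, Nat.mod_self]
    · rcases Nat.eq_zero_or_pos r with hr0 | hr0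
      · omega
      · rw [Nat.mod_eq_of_lt (by omega)]; omega
  · intro hz
    rcases Nat.eq_zero_or_pos r with hr0 | hr0
    · rw [hr0, Nat.sub_zero, Nat.mod_self] at hz
      subst hz
      exact ⟨hp, by rw [hr0]; simp⟩
    · rw [Nat.mod_eq_of_lt (by omega)] at hz
      subst hz
      exact ⟨by omega, ⟨1, by omega⟩⟩

/-- The indicator sum form: `Σ_{z < p−1} [p ∣ z + c] + [p ∣ (p − 1) + c] = 1` (peel `z = p − 1` off
`card_filter_range_dvd_add`). [folklore] -/
theorem sum_range_pred_indicator_dvd (hp : 0 < p) (c : ℕ) :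
    (∑ z ∈ Finset.range (p - 1), if p ∣ z + c then 1 else 0) + (if p ∣ (p - 1) + c then 1 else 0) = 1 := by
  classical
  have h := card_filter_range_dvd_add hp c
  rw [Finset.card_filter, show p = (p - 1) + 1 by omega, Finset.sum_range_succ,
    show p - 1 + 1 = p by omega] at h
  exact h

/-- Two coordinates: `Σ_{y,z < p−1} [p ∣ y + z + c] + Σ_{y < p−1} [p ∣ y + (p − 1 + c)] = p − 1`. [folklore] -/
theorem sum_two_indicator_dvd (hp : 0 < p) (c : ℕ) :
    (∑ y ∈ Finset.range (p - 1), ∑ z ∈ Finset.range (p - 1), if p ∣ z + (y + c) then 1 else 0) +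
      (∑ y ∈ Finset.range (p - 1), if p ∣ y + (p - 1 + c) then 1 else 0) = p - 1 := by
  rw [← Finset.sum_add_distrib]
  have h : ∀ y ∈ Finset.range (p - 1),
      ((∑ z ∈ Finset.range (p - 1), if p ∣ z + (y + c) then 1 else 0) +
        (if p ∣ y + (p - 1 + c) then 1 else 0)) = 1 := by
    intro y _
    have h1 := sum_range_pred_indicator_dvd hp (y + c)
    rwa [show p - 1 + (y + c) = y + (p - 1 + c) by omega] at h1
  rw [Finset.sum_congr rfl h, Finset.sum_const, Finset.card_range, smul_eq_mul, mul_one]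

/-- Three coordinates: **`Σ_{x,y,z < p−1} [p ∣ x + y + z + c] + [p ∣ 3p − 3 + c] = (p − 1)(p − 2) + 1`**. [folklore] -/
theorem sum_three_indicator_dvd (hp : 2 ≤ p) (c : ℕ) :
    (∑ x ∈ Finset.range (p - 1), ∑ y ∈ Finset.range (p - 1), ∑ z ∈ Finset.range (p - 1),
        if p ∣ z + (y + (x + c)) then 1 else 0) + (if p ∣ (p - 1) + (p - 1 + (p - 1 + c)) then 1 else 0) =
      (p - 1) * (p - 2) + 1 := by
  have hp0 : 0 < p := by omega
  -- peel: `T₂(x + c) + T₁(p − 1 + x + c) = p − 1` and `T₁(p−1+x+c)` summed over `x` is `1 − δ`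
  have h2 : ∀ x ∈ Finset.range (p - 1),
      (∑ y ∈ Finset.range (p - 1), ∑ z ∈ Finset.range (p - 1), if p ∣ z + (y + (x + c)) then 1 else 0) +
        (∑ y ∈ Finset.range (p - 1), if p ∣ y + (p - 1 + (x + c)) then 1 else 0) = p - 1 :=
    fun x _ ↦ sum_two_indicator_dvd hp0 (x + c)
  have h3 := sum_range_pred_indicator_dvd hp0 (p - 1 + (p - 1 + c))
  -- `Σ_x T₁(p−1+x+c) = T₁'(2p−2+c)` after reindexing `y + (p−1+(x+c)) = x + (p−1+(p−1+c))`… sum over x of sums over y: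
  have hswap : (∑ x ∈ Finset.range (p - 1), ∑ y ∈ Finset.range (p - 1),
      if p ∣ y + (p - 1 + (x + c)) then 1 else 0) =
      ∑ y ∈ Finset.range (p - 1), ∑ x ∈ Finset.range (p - 1), if p ∣ x + (y + (p - 1 + c)) then 1 else 0 := by
    rw [Finset.sum_comm]
    refine Finset.sum_congr rfl fun y _ ↦ Finset.sum_congr rfl fun x _ ↦ ?_
    rw [show y + (p - 1 + (x + c)) = x + (y + (p - 1 + c)) by omega]
  have h2' := sum_two_indicator_dvd hp0 (p - 1 + c)
  -- assemble
  have hsum := Finset.sum_congr rfl h2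
  rw [Finset.sum_add_distrib, Finset.sum_const, Finset.card_range, smul_eq_mul, hswap] at hsum
  have e3 : ∀ y, y + (p - 1 + (p - 1 + c)) = y + (p - 1 + (p - 1 + c)) := fun _ ↦ rfl
  have hp1 : 1 ≤ p - 1 := by omega
  -- from `A + B = (p-1)(p-1)`, `B + C = p - 1`, `C + δ = 1` deduce `A + δ = (p-1)(p-2) + 1`
  have hmul : (p - 1) * (p - 1) = (p - 1) * (p - 2) + (p - 1) := by
    rw [show p - 1 = (p - 2) + 1 from by omega]
    ring_nf
  omega

end Counting

/-! ### §2 Triples in a box: partition by the sum, symmetry -/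

section Box

variable {p : ℕ}

/-- For `β ∈ [0, p−2]³` (as triples) and `4 ≤ c ≤ p + 2`: `p ∣ |β| + c` iff `|β| ∈ {p − c (if c ≤ p), 2p − c, 3p − c}`
(`|β| + c ∈ (0, 4p)`). [folklore] -/
theorem dvd_sum_add_iff (hp : 2 ≤ p) {c : ℕ} (hc4 : 4 ≤ c) (hcp : c ≤ p + 2) {x y z : ℕ}
    (hx : x < p - 1) (hy : y < p - 1) (hz : z < p - 1) :
    p ∣ z + (y + (x + c)) ↔
      (x + y + z = p - c ∧ c ≤ p) ∨ x + y + z = 2 * p - c ∨ x + y + z = 3 * p - c := by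
  constructor
  · rintro ⟨k, hk⟩
    have hk1 : 0 < k := by
      rcases Nat.eq_zero_or_pos k with rfl | h
      · omega
      · exact h
    have hk4 : k < 4 := Nat.lt_of_mul_lt_mul_left (a := p) (by omega)
    interval_cases k <;> omega
  · rintro (⟨h, hc⟩ | h | h)
    · exact ⟨1, by omega⟩
    · exact ⟨2, by omega⟩
    · exact ⟨3, by omega⟩

/-- **Partition of the residue-class count by the value of the sum**: with `R = [0, p−1)`,
`Σ_{x,y,z ∈ R} [p ∣ x+y+z+c] = [c ≤ p]·M(p−c) + M(2p−c) + M(3p−c)`, `M(t) = #{(x,y,z) ∈ R³ : x+y+z = t}`,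
for `4 ≤ c ≤ p + 2`. [folklore] -/
theorem sum_three_indicator_eq_card (hp : 2 ≤ p) {c : ℕ} (hc4 : 4 ≤ c) (hcp : c ≤ p + 2) :
    (∑ x ∈ Finset.range (p - 1), ∑ y ∈ Finset.range (p - 1), ∑ z ∈ Finset.range (p - 1),
        if p ∣ z + (y + (x + c)) then 1 else 0) =
      (if c ≤ p then ((Finset.range (p - 1) ×ˢ (Finset.range (p - 1) ×ˢ Finset.range (p - 1))).filter
          fun w => w.1 + w.2.1 + w.2.2 = p - c).card else 0) +
        ((Finset.range (p - 1) ×ˢ (Finset.range (p - 1) ×ˢ Finset.range (p - 1))).filter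
          fun w => w.1 + w.2.1 + w.2.2 = 2 * p - c).card +
        ((Finset.range (p - 1) ×ˢ (Finset.range (p - 1) ×ˢ Finset.range (p - 1))).filter
          fun w => w.1 + w.2.1 + w.2.2 = 3 * p - c).card := by
  classical
  set R := Finset.range (p - 1) with hR
  set S := R ×ˢ (R ×ˢ R) with hS
  -- the triple sum is a sum over `S`
  have hLHS : (∑ x ∈ R, ∑ y ∈ R, ∑ z ∈ R, if p ∣ z + (y + (x + c)) then 1 else 0) =
      (S.filter fun w => p ∣ w.2.2 + (w.2.1 + (w.1 + c))).card := by
    rw [Finset.card_filter, hS, Finset.sum_product]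
    refine Finset.sum_congr rfl fun x _ ↦ ?_
    rw [Finset.sum_product]
  rw [hLHS]
  -- membership split
  have hmemR : ∀ {w : ℕ × ℕ × ℕ}, w ∈ S → w.1 < p - 1 ∧ w.2.1 < p - 1 ∧ w.2.2 < p - 1 := by
    intro w hw
    simp only [hS, hR, Finset.mem_product, Finset.mem_range] at hw
    exact ⟨hw.1, hw.2.1, hw.2.2⟩
  have hsplit : (S.filter fun w => p ∣ w.2.2 + (w.2.1 + (w.1 + c))) =
      S.filter (fun w => (w.1 + w.2.1 + w.2.2 = p - c ∧ c ≤ p) ∨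
        (w.1 + w.2.1 + w.2.2 = 2 * p - c ∨ w.1 + w.2.1 + w.2.2 = 3 * p - c)) := by
    refine Finset.filter_congr fun w hw ↦ ?_
    obtain ⟨hx, hy, hz⟩ := hmemR hw
    exact dvd_sum_add_iff hp hc4 hcp hx hy hz
  have hdAB : Disjoint (S.filter fun w => w.1 + w.2.1 + w.2.2 = p - c ∧ c ≤ p)
      (S.filter fun w => w.1 + w.2.1 + w.2.2 = 2 * p - c ∨ w.1 + w.2.1 + w.2.2 = 3 * p - c) := by
    rw [Finset.disjoint_filter]
    intro w _ h1 h2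
    omega
  have hdBC : Disjoint (S.filter fun w => w.1 + w.2.1 + w.2.2 = 2 * p - c)
      (S.filter fun w => w.1 + w.2.1 + w.2.2 = 3 * p - c) := by
    rw [Finset.disjoint_filter]
    intro w _ h1 h2
    omega
  have hA : (S.filter fun w => w.1 + w.2.1 + w.2.2 = p - c ∧ c ≤ p).card =
      if c ≤ p then (S.filter fun w => w.1 + w.2.1 + w.2.2 = p - c).card else 0 := by
    by_cases hc : c ≤ p
    · rw [if_pos hc]
      congr 1
      exact Finset.filter_congr fun w _ ↦ ⟨fun h ↦ h.1, fun h ↦ ⟨h, hc⟩⟩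
    · rw [if_neg hc, Finset.card_eq_zero, Finset.filter_eq_empty_iff]
      intro w _ h
      exact hc h.2
  rw [hsplit, Finset.filter_or, Finset.card_union_of_disjoint hdAB, Finset.filter_or,
    Finset.card_union_of_disjoint hdBC, hA, add_assoc]

/-- **Symmetry of the box count** `M(3m − t) = M(t)` on `[0, m]³` (the involution `w ↦ (m,m,m) − w`). [folklore] -/
theorem card_box_sum_symm (m t : ℕ) (ht : t ≤ 3 * m) :
    ((Finset.range (m + 1) ×ˢ (Finset.range (m + 1) ×ˢ Finset.range (m + 1))).filter
        fun w => w.1 + w.2.1 + w.2.2 = 3 * m - t).card =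
      ((Finset.range (m + 1) ×ˢ (Finset.range (m + 1) ×ˢ Finset.range (m + 1))).filter
        fun w => w.1 + w.2.1 + w.2.2 = t).card := by
  refine Finset.card_bij' (fun w _ => (m - w.1, (m - w.2.1, m - w.2.2)))
    (fun w _ => (m - w.1, (m - w.2.1, m - w.2.2))) ?_ ?_ ?_ ?_
  · intro w hw
    simp only [Finset.mem_filter, Finset.mem_product, Finset.mem_range] at hw ⊢
    omega
  · intro w hw
    simp only [Finset.mem_filter, Finset.mem_product, Finset.mem_range] at hw ⊢
    omega
  · intro w hw
    simp only [Finset.mem_filter, Finset.mem_product, Finset.mem_range] at hw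
    ext <;> simp only <;> omega
  · intro w hw
    simp only [Finset.mem_filter, Finset.mem_product, Finset.mem_range] at hw
    ext <;> simp only <;> omega

/-- The box count vanishes beyond the top degree: `M(t) = 0` for `t > 3m`. [folklore] -/
theorem card_box_sum_eq_zero (m t : ℕ) (ht : 3 * m < t) :
    ((Finset.range (m + 1) ×ˢ (Finset.range (m + 1) ×ˢ Finset.range (m + 1))).filter
        fun w => w.1 + w.2.1 + w.2.2 = t).card = 0 := by
  rw [Finset.card_eq_zero, Finset.filter_eq_empty_iff]
  intro w hw h
  simp only [Finset.mem_product, Finset.mem_range] at hw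
  omega

/-- **Triples are finitely supported functions on `Fin 3`**: the box count `M(t)` on `[0, m]³` equals the count
`#{β : Fin 3 →₀ ℕ, |β| = t, βᵢ ≤ m}` of `hilbert_jacobianIdeal_eq_card`. [folklore] -/
theorem card_box_sum_eq_card_finsuppAntidiag (m t : ℕ) :
    ((Finset.range (m + 1) ×ˢ (Finset.range (m + 1) ×ˢ Finset.range (m + 1))).filter
        fun w => w.1 + w.2.1 + w.2.2 = t).card =
      ((Finset.univ.finsuppAntidiag t).filter fun β : Fin 3 →₀ ℕ => ∀ i, β i ≤ m).card := by
  classical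
  refine Finset.card_bij' (fun w _ => Finsupp.equivFunOnFinite.symm ![w.1, w.2.1, w.2.2])
    (fun β _ => (β 0, (β 1, β 2))) ?_ ?_ ?_ ?_
  · intro w hw
    simp only [Finset.mem_filter, Finset.mem_product, Finset.mem_range] at hw
    simp only [Finset.mem_filter, Finset.mem_finsuppAntidiag, Finset.subset_univ, and_true,
      Fin.sum_univ_three, Finsupp.coe_equivFunOnFinite_symm, Matrix.cons_val_zero,
      Matrix.cons_val_one, Matrix.cons_val_two, Matrix.tail_cons, Matrix.head_cons]
    refine ⟨by omega, fun i ↦ ?_⟩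
    fin_cases i <;> simp <;> omega
  · intro β hβ
    simp only [Finset.mem_filter, Finset.mem_finsuppAntidiag, Fin.sum_univ_three] at hβ
    simp only [Finset.mem_filter, Finset.mem_product, Finset.mem_range]
    have h0 := hβ.2 0
    have h1 := hβ.2 1
    have h2 := hβ.2 2
    omega
  · intro w hw
    ext <;> simp
  · intro β hβ
    ext i
    fin_cases i <;> simp

end Box

/-! ### §3 The two identities for the Jacobian ring of a smooth ternary form -/

section Hilbert

open Summit.HodgeConjecture.HodgeConjecture.Theorems.CyclicUnitaryPowersCyclicCoverIrreducible
  (exists_X_pow_mem_jacobianIdeal_of_isSmoothProjective)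

variable {p : ℕ} {f : MvPolynomial (Fin 3) ℂ}

/-- **Macaulay: `dim R_f^a = #{(x,y,z) ∈ [0, p−2]³ : x + y + z = a}`** for a ternary form `f` of degree `p ≥ 2`
whose `p`-cyclic cover `x₃^p = f` is smooth (so `V(f)` is smooth and `R_f` Artinian; the tree's
`hilbert_jacobianIdeal_eq_card` with `exists_X_pow_mem_jacobianIdeal_of_isSmoothProjective`).
[cite: Kloosterman2023, §2 eq. (1)] -/
theorem hilbert_jacobianIdeal_eq_card_box (hp : 2 ≤ p) (hf : f.IsHomogeneous p) (hf0 : f ≠ 0)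
    (hXF : IsSmoothProjective 2 (SmoothHypersurface.hypersurface (cyclicCoverForm p f))) (a : ℕ) :
    Module.finrank ℂ ↥(homogeneousSubmodule (Fin 3) ℂ a) -
        Module.finrank ℂ ↥(idealDegree (UniversalHypersurface.jacobianIdeal f) a) =
      ((Finset.range (p - 1) ×ˢ (Finset.range (p - 1) ×ˢ Finset.range (p - 1))).filter
        fun w => w.1 + w.2.1 + w.2.2 = a).card := by
  obtain ⟨M, -, hXM⟩ := exists_X_pow_mem_jacobianIdeal_of_isSmoothProjective hp hf hf0 hXF
  rw [hilbert_jacobianIdeal_eq_card hf hp hXM a, show p - 1 = p - 2 + 1 by omega,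
    card_box_sum_eq_card_finsuppAntidiag]

/-- **Gorenstein symmetry of `R_f` across the three pole orders**: for `1 ≤ i ≤ p − 1`,
`dim R_f^{3p−3−i} = dim R_f^{i−3}` (and `= 0` for `i < 3`), both sides in the binder's spelling
`dim S₃^a − dim J_f^a` — the socle degree of the complete intersection `R_f` is `3(p−2)` and
`dim R_f^a = dim R_f^{3p−6−a}`. [cite: Kloosterman2023, §2 eq. (1)] [cite: CarlsonToledo1999, §5] -/
theorem hilbert_jacobianIdeal_symm (hp : 3 ≤ p) (hf : f.IsHomogeneous p) (hf0 : f ≠ 0)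
    (hXF : IsSmoothProjective 2 (SmoothHypersurface.hypersurface (cyclicCoverForm p f)))
    {i : ℕ} (hip : i < p) :
    Module.finrank ℂ ↥(homogeneousSubmodule (Fin 3) ℂ (3 * p - 3 - i)) -
        Module.finrank ℂ ↥(idealDegree (UniversalHypersurface.jacobianIdeal f) (3 * p - 3 - i)) =
      if i < 3 then 0 else
        Module.finrank ℂ ↥(homogeneousSubmodule (Fin 3) ℂ (i - 3)) -
          Module.finrank ℂ ↥(idealDegree (UniversalHypersurface.jacobianIdeal f) (i - 3)) := by
  rw [hilbert_jacobianIdeal_eq_card_box (by omega) hf hf0 hXF]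
  by_cases hi3 : i < 3
  · rw [if_pos hi3]
    have h := card_box_sum_eq_zero (p - 2) (3 * p - 3 - i) (by omega)
    rwa [show p - 2 + 1 = p - 1 by omega] at h
  · rw [if_neg hi3, hilbert_jacobianIdeal_eq_card_box (by omega) hf hf0 hXF]
    have h := card_box_sum_symm (p - 2) (i - 3) (by omega)
    rwa [show p - 2 + 1 = p - 1 by omega, show 3 * (p - 2) - (i - 3) = 3 * p - 3 - i by omega] at h

/-- **The three residue degrees of one eigenvalue fill a residue class**: for `p ≥ 3` and `1 ≤ i ≤ p − 1`,
`dim R_f^{p−3−i} + dim R_f^{2p−3−i} + dim R_f^{3p−3−i} = p² − 3p + 3` (the first term read as `0` when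
`p < 3 + i`), in the binder's spelling. The three degrees are the members of `[0, 3p−6]` congruent to
`−3 − i (mod p)`, and `#{β ∈ [0,p−2]³ : p ∣ |β| + i + 3} = (p−1)(p−2) + 1` (`sum_three_indicator_dvd`:
each residue class mod `p` meets `[0, p−2]` once, except one). This is the identity behind
`dim H²(X_F)_{ζ^i} = h^{2,0}_{ζ^i} + h^{1,1}_{ζ^i} + h^{0,2}_{ζ^i} = p² − 3p + 3` for the `p`-cyclic covers.
[cite: CarlsonToledo1999, §5] [cite: Kloosterman2023, §2 eq. (1)] -/
theorem hilbert_jacobianIdeal_three_term (hp : 3 ≤ p) (hf : f.IsHomogeneous p) (hf0 : f ≠ 0)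
    (hXF : IsSmoothProjective 2 (SmoothHypersurface.hypersurface (cyclicCoverForm p f)))
    {i : ℕ} (hi : 1 ≤ i) (hip : i < p) :
    (if p < 3 + i then 0 else
        Module.finrank ℂ ↥(homogeneousSubmodule (Fin 3) ℂ (p - 3 - i)) -
          Module.finrank ℂ ↥(idealDegree (UniversalHypersurface.jacobianIdeal f) (p - 3 - i))) +
      (Module.finrank ℂ ↥(homogeneousSubmodule (Fin 3) ℂ (2 * p - 3 - i)) -
          Module.finrank ℂ ↥(idealDegree (UniversalHypersurface.jacobianIdeal f) (2 * p - 3 - i))) +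
      (Module.finrank ℂ ↥(homogeneousSubmodule (Fin 3) ℂ (3 * p - 3 - i)) -
          Module.finrank ℂ ↥(idealDegree (UniversalHypersurface.jacobianIdeal f) (3 * p - 3 - i))) =
      p ^ 2 - 3 * p + 3 := by
  have hp2 : 2 ≤ p := by omega
  -- the residue-class count
  have T := sum_three_indicator_dvd hp2 (i + 3)
  have hndvd : ¬ p ∣ (p - 1) + (p - 1 + (p - 1 + (i + 3))) := by
    rintro ⟨k, hk⟩
    have h3 : 3 < k := Nat.lt_of_mul_lt_mul_left (a := p) (by omega)
    have h4 : k < 4 := Nat.lt_of_mul_lt_mul_left (a := p) (by omega)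
    omega
  rw [if_neg hndvd, add_zero, sum_three_indicator_eq_card hp2 (by omega) (by omega)] at T
  -- rewrite the three Hilbert values as box counts
  rw [hilbert_jacobianIdeal_eq_card_box hp2 hf hf0 hXF (2 * p - 3 - i),
    hilbert_jacobianIdeal_eq_card_box hp2 hf hf0 hXF (3 * p - 3 - i),
    show 2 * p - 3 - i = 2 * p - (i + 3) by omega, show 3 * p - 3 - i = 3 * p - (i + 3) by omega]
  have hpoly : (p - 1) * (p - 2) + 1 = p ^ 2 - 3 * p + 3 := by
    obtain ⟨k, rfl⟩ : ∃ k, p = k + 3 := ⟨p - 3, by omega⟩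
    rw [show k + 3 - 1 = k + 2 by omega, show k + 3 - 2 = k + 1 by omega]
    zify [(by nlinarith : 3 * (k + 3) ≤ (k + 3) ^ 2)]
    ring
  rw [← hpoly, ← T]
  by_cases hlt : p < 3 + i
  · rw [if_pos hlt, if_neg (by omega)]
  · rw [if_neg hlt, if_pos (by omega), hilbert_jacobianIdeal_eq_card_box hp2 hf hf0 hXF,
      show p - 3 - i = p - (i + 3) by omega]

end Hilbert

end Summit.HodgeConjecture.HodgeConjecture.Theorems.CyclicUnitaryPowersJacobianHilbertIdentities

end
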